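import Summits.Ventures.YMGap.Thresholds.TorusStateResponseBound
import Summits.Ventures.YMGap.Thresholds.StarMassGapSUN
import HarnessLib

/-!
# Venture YMGap — every `SU(N)`, `d = 4`: UNIFORM BOUND ON THE COUPLING DERIVATIVE OF THE TORUS STATES from a
# one-link modulus, and C-LIP AT THE STAR WINDOW (hypothesis-free for `N ≥ 2` at 't Hooft `0 ≤ β/N ≤ 9/308`)

HONEST FRAMING: venture file of the cell `pub-ymgap` (QuantumFields programme), seat ds-1; the generic-`N` form of
`TorusStateResponseBound` (`SU(2)`).  Strong-coupling LATTICE statements for `SU(N)` lattice Yang–Mills on `ℤ^4`,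
Wilson action at tree (bare) coupling `b` (`'t Hooft b/N`), inside the one-sided vertex-star window generated by a
one-link Kantorovich modulus `OneLinkKRModulus N R K` (`StarLemmaGSUN.star_window_of_oneLinkKRModulus`): Lipschitz
statements in the coupling; nothing about the continuum, confinement at weak coupling, or the Clay problem.

INPUT: `OneLinkKRModulus N R K` (`K ≥ 0`), a top coupling `b₁` with `6 b₁/N ≤ R` and `4K b₁/N ≤ 9/25`; then every
`0 ≤ b ≤ b₁` has the star windows on every torus `L ≥ 3` with ONE received sum `ρ₁ = R_G(4K b₁/N) < 1`
(`star_window_uniform`).  OUTPUT: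
* `abs_cov_plaquette_torusState_le_SU` — one term: `|Cov_{torusState b L}(F, W_{(s y;i,j)})| ≤ A_N r^{‖x₀ − s y‖₁}`,
  `A_N = 4(2√N)² e^{κ(D+3)} (#Λ K_F) (16 N³)`, `r = e^{−κ/4}`, `κ = starRate ρ`;
* `abs_responseSum_torusState_le_SU` — the torus derivative `Σ_y Σ_{i<j} N·Cov(F, W)` is bounded by
  `N · D₄ · A_N ((1+r)/(1−r))^4` uniformly in `L`;
* `abs_integral_torusState_sub_le_SU` — the torus state is Lipschitz in `b` on `[0, b₁]`, uniformly in `L > 4D + 4`;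
* `abs_integral_sub_integral_le_star_SU` — C-LIP AT THE STAR WINDOW on `ℤ^4` for the (unique) DLR states at
  `0 ≤ b, b' ≤ b₁`; ★ `abs_integral_sub_integral_le_SU_thooft` — every `N ≥ 2`, HYPOTHESIS-FREE (Bakry–Émery modulus
  `oneLinkKRModulus_SU`), at 't Hooft `0 ≤ b/N, b'/N ≤ 9/308`.

References (mechanism only): R. L. Dobrushin, S. B. Shlosman (1985); H. Shen, R. Zhu, X. Zhu, CMP 400 (2023) Lemma 4.1
(the Bakry–Émery one-link bound); B. Simon (1993) §II.1.
-/

noncomputable section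

open MeasureTheory ProbabilityTheory Function Finset Filter Topology Real
open scoped NNReal
open Literature.Probability.LatticeModels (Torus.proj Torus.proj_apply HasUniqueGibbsMeasure)
open Literature.MathematicalPhysics.QuantumLattice (LGConfig ZdEdge ZdPlaquette plaquetteEdges torusLift torusEdge
  toTorusObservable toTorusObservable_apply fundamentalRep continuous_fundamentalRep ymSpecification ymGibbsMeasures)
open Literature.MathematicalPhysics.QuantumFieldTheory hiding ZdEdge
open Literature.MathematicalPhysics.QuantumFieldTheory.Balaban1983to89.StrongCouplingTorusWindow
open Literature.MathematicalPhysics.QuantumFieldTheory.Balaban1983to89.StrongCouplingDobrushinWindow (OneLinkKRModulus)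
open Literature.MathematicalPhysics.QuantumFieldTheory.Balaban1983to89.StrongCouplingKernelWindow (oneLinkKRModulus_SU)
open Summit.Ventures.YMGap.DSWindow (starRate starRate_pos gaugeR_mono linkEnds vertexStar starWin IsLinkWindowContraction)
open Summit.Ventures.YMGap.StarWindowGauge (gaugeR gaugeR_lt_one_of_le)
open Summit.Ventures.YMGap.StarLemmaG (gaugeR_nonneg)
open Summit.Ventures.YMGap.StarLemmaGSUN (star_window_of_oneLinkKRModulus)
open Summit.Ventures.YMGap.StarLimit (continuous_of_isLipschitzCylinder)
open Summit.Ventures.YMGap.RobustBall (l1 l1_sub_comm numOrient sum_pow_l1_sub_le)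
open Summit.Ventures.YMGap.PlaquetteSusceptibility (l1_le_mul_norm)

namespace Summit.Ventures.YMGap.CouplingResponse

variable {N : ℕ}

/-! ### §1 One term -/

section OneTerm

variable {L : ℕ} [NeZero L]

/-- **One term of the response sum, `SU(N)`.**  Torus `(ℤ/L)^4` carrying a vertex-indexed influence array for the star
windows of the `SU(N)` Wilson specification at coupling `b` (four clauses, received sums `≤ ρ < 1`); `F` a Lipschitz
cylinder (support `Λ`, constant `K`, links based within `D` of `x₀`), `4D + 4 < L`; `s` a centred lift at `x₀`.  Then
`|Cov_{torusState b L}(F, W_{(s y; i, j)})| ≤ 4(2√N)² e^{κ(D+3)} (#Λ K)(16N³) · (e^{−κ/4})^{‖x₀ − s y‖₁}`, `κ = starRate ρ`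
(`StarSUNLimit.star_torus_cov_lipschitz` with separation `‖s y − x₀‖_∞ − D − 1`). [folklore] -/
theorem abs_cov_plaquette_torusState_le_SU (b : ℝ) {ρ : ℝ} (hρ0 : 0 ≤ ρ) (hρ1 : ρ < 1)
    (hW : ∃ Kw : Site 4 L → Edge 4 L → Edge 4 L → ℝ,
      (∀ s y x, 0 ≤ Kw s y x) ∧ (∀ s y x, Kw s y x ≠ 0 → ∀ w ∈ linkEnds y, torusNorm (s - w) ≤ 1) ∧
      IsLinkWindowContraction (d := 4) (L := L) (wilsonPlaqWeight N b) suFrobDist starWin (fun c => Kw c.1) ∧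
      ∀ (s : Site 4 L) (x : Edge 4 L), x ∈ vertexStar s → ∑ y, Kw s y x ≤ ρ)
    {F : LGConfig 4 (Matrix.specialUnitaryGroup (Fin N) ℂ) → ℝ} {Λ : Finset (ZdEdge 4)} {K : ℝ≥0}
    (hF : IsLipschitzCylinder (fundamentalRep (Fin N)) F Λ K)
    {x₀ : Literature.Probability.LatticeModels.Site 4} {D : ℕ} (hD : ∀ e ∈ Λ, ‖e.1 - x₀‖ ≤ D) (hL : 4 * D + 4 < L)
    {s : Site 4 L → Literature.Probability.LatticeModels.Site 4} (hs : ∀ y, (Torus.proj L (s y) : Site 4 L) = y)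
    (hcen : ∀ y, torusNorm (y - Torus.proj L x₀) = Literature.Probability.LatticeModels.Site.supNorm (s y - x₀))
    (y : Site 4 L) (p : {p : Fin 4 × Fin 4 // p.1 < p.2}) :
    |cov[F, zdPlaquetteObs (fundamentalRep (Fin N)) (s y) p.1.1 p.1.2;
        torusState (d := 4) (fundamentalRep (Fin N)) b L]| ≤
      4 * (2 * Real.sqrt N) ^ 2 * Real.exp (starRate ρ * (D + 3)) * ((Λ.card : ℝ) * K) * (16 * (N : ℝ) ^ 3) *
        Real.exp (-(starRate ρ / 4)) ^ l1 (x₀ - s y) := by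
  classical
  haveI : SecondCountableTopology (Matrix (Fin N) (Fin N) ℂ) :=
    inferInstanceAs (SecondCountableTopology (Fin N → Fin N → ℂ))
  haveI : SecondCountableTopology (Matrix.specialUnitaryGroup (Fin N) ℂ) :=
    Topology.IsEmbedding.subtypeVal.secondCountableTopology
  obtain ⟨Kw, hKw, hKloc, hH1, hsum⟩ := hW
  set q : ZdPlaquette 4 := (s y, p) with hq
  have hP := isLipschitzCylinder_zdPlaquetteObs (N := N) (d := 4) (s y) p.2
  have hPm := hP.measurable
  have hcov : cov[F, zdPlaquetteObs (fundamentalRep (Fin N)) (s y) p.1.1 p.1.2;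
      torusState (d := 4) (fundamentalRep (Fin N)) b L] =
      cov[toTorusObservable L F, toTorusObservable L (zdPlaquetteObs (fundamentalRep (Fin N)) (s y) p.1.1 p.1.2);
        wilsonMeasure (d := 4) (L := L) (fundamentalRep (Fin N)) b] := by
    rw [torusState, covariance_map hF.measurable.aestronglyMeasurable hPm.aestronglyMeasurable
      (measurable_torusLift L).aemeasurable]
    rfl
  rw [hcov]
  have hinj₁ := torusEdge_injOn_of_norm_le (L := L) hD (by omega)
  have hDq : ∀ e ∈ plaquetteEdges q, ‖e.1 - q.1‖ ≤ ((1 : ℕ) : ℝ) := fun e he => by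
    simpa using norm_fst_sub_le_of_mem_plaquetteEdges he
  have hinj₂ := torusEdge_injOn_of_norm_le (L := L) hDq (by omega)
  set n : ℕ := torusNorm (y - Torus.proj L x₀) with hn
  have hgeom : ∀ a ∈ Λ, ∀ e ∈ plaquetteEdges q,
      n - (D + 1) ≤ torusNorm ((torusEdge L a).1 - (torusEdge L e).1) := by
    intro a ha e he
    have h1 : (torusNorm ((torusEdge L a).1 - (Torus.proj L x₀ : Site 4 L)) : ℝ) ≤ D := by
      simp only [torusEdge]
      rw [← torusProj_site_sub]
      exact (torusNorm_proj_le_norm L _).trans (hD a ha)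
    have h2 : (torusNorm (y - (torusEdge L e).1) : ℝ) ≤ 1 := by
      simp only [torusEdge]
      rw [← hs y, ← torusProj_site_sub]
      refine (torusNorm_proj_le_norm L _).trans ?_
      have := hDq e he
      rw [hq] at this
      simpa [norm_sub_rev] using this
    have h1' : torusNorm ((torusEdge L a).1 - (Torus.proj L x₀ : Site 4 L)) ≤ D := by exact_mod_cast h1
    have h2' : torusNorm (y - (torusEdge L e).1) ≤ 1 := by exact_mod_cast h2
    have htri : n ≤ torusNorm (y - (torusEdge L e).1) +
        (torusNorm ((torusEdge L e).1 - (torusEdge L a).1) + torusNorm ((torusEdge L a).1 - Torus.proj L x₀)) :=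
      (torusNorm_sub_le _ _ _).trans (Nat.add_le_add_left (torusNorm_sub_le _ _ _) _)
    have hsymm : torusNorm ((torusEdge L e).1 - (torusEdge L a).1) = torusNorm ((torusEdge L a).1 - (torusEdge L e).1) := by
      rw [← torusNorm_neg, neg_sub]
    omega
  have key := StarSUNLimit.star_torus_cov_lipschitz (L := L) b hρ0 hρ1 hKw hKloc hH1 hsum hF hP hinj₁ hinj₂ hgeom
  refine key.trans ?_
  have hκ := starRate_pos hρ0 hρ1
  have hcard : (((plaquetteEdges q).card : ℝ) * ((4 * (N : ℝ≥0) ^ 3 : ℝ≥0) : ℝ)) ≤ 16 * (N : ℝ) ^ 3 := by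
    have hc : ((plaquetteEdges q).card : ℝ) ≤ 4 := by exact_mod_cast card_plaquetteEdges_le q
    have hN3 : (0 : ℝ) ≤ (N : ℝ) ^ 3 := by positivity
    push_cast
    nlinarith
  have hexp : Real.exp (-(starRate ρ * ((n - (D + 1) - 2 : ℕ) : ℝ))) ≤
      Real.exp (starRate ρ * (D + 3)) * Real.exp (-(starRate ρ / 4)) ^ l1 (x₀ - s y) := by
    rw [← Real.exp_nat_mul, ← Real.exp_add]
    refine Real.exp_le_exp.2 ?_
    have hsub : (n : ℝ) - (D + 3) ≤ ((n - (D + 1) - 2 : ℕ) : ℝ) := by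
      have : (n : ℤ) - (D + 3) ≤ ((n - (D + 1) - 2 : ℕ) : ℤ) := by omega
      exact_mod_cast this
    have hl1 : (l1 (x₀ - s y) : ℝ) ≤ 4 * n := by
      rw [l1_sub_comm, hn, hcen y, ← Literature.Probability.LatticeModels.Site.norm_eq_supNorm]
      have := l1_le_mul_norm (d := 4) (s y - x₀)
      push_cast at this
      linarith
    nlinarith
  have hA : 0 ≤ 4 * (2 * Real.sqrt N) ^ 2 := by positivity
  have hΛK : 0 ≤ (Λ.card : ℝ) * K := by positivity
  calc 4 * (2 * Real.sqrt N) ^ 2 * Real.exp (-(starRate ρ * ((n - (D + 1) - 2 : ℕ) : ℝ))) *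
        ((Λ.card : ℝ) * K) * (((plaquetteEdges q).card : ℝ) * ((4 * (N : ℝ≥0) ^ 3 : ℝ≥0) : ℝ))
      ≤ 4 * (2 * Real.sqrt N) ^ 2 * (Real.exp (starRate ρ * (D + 3)) * Real.exp (-(starRate ρ / 4)) ^ l1 (x₀ - s y)) *
        ((Λ.card : ℝ) * K) * (16 * (N : ℝ) ^ 3) := by
        gcongr
  _ = _ := by ring

end OneTerm

/-! ### §2 The response sum, uniformly in the volume -/

section Sum

variable {L : ℕ} [NeZero L]

/-- **Uniform bound on the `SU(N)` torus derivative** `Σ_y Σ_{i<j} N·Cov(F, W_{(s y;i,j)})` (the output of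
`hasDerivAt_integral_torusState_SU`): `≤ N · D₄ · A_N ((1+r)/(1−r))^4`, independent of `L`. [folklore] -/
theorem abs_responseSum_torusState_le_SU (b : ℝ) {ρ : ℝ} (hρ0 : 0 ≤ ρ) (hρ1 : ρ < 1)
    (hW : ∃ Kw : Site 4 L → Edge 4 L → Edge 4 L → ℝ,
      (∀ s y x, 0 ≤ Kw s y x) ∧ (∀ s y x, Kw s y x ≠ 0 → ∀ w ∈ linkEnds y, torusNorm (s - w) ≤ 1) ∧
      IsLinkWindowContraction (d := 4) (L := L) (wilsonPlaqWeight N b) suFrobDist starWin (fun c => Kw c.1) ∧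
      ∀ (s : Site 4 L) (x : Edge 4 L), x ∈ vertexStar s → ∑ y, Kw s y x ≤ ρ)
    {F : LGConfig 4 (Matrix.specialUnitaryGroup (Fin N) ℂ) → ℝ} {Λ : Finset (ZdEdge 4)} {K : ℝ≥0}
    (hF : IsLipschitzCylinder (fundamentalRep (Fin N)) F Λ K)
    {x₀ : Literature.Probability.LatticeModels.Site 4} {D : ℕ} (hD : ∀ e ∈ Λ, ‖e.1 - x₀‖ ≤ D) (hL : 4 * D + 4 < L)
    {s : Site 4 L → Literature.Probability.LatticeModels.Site 4} (hs : ∀ y, (Torus.proj L (s y) : Site 4 L) = y)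
    (hcen : ∀ y, torusNorm (y - Torus.proj L x₀) = Literature.Probability.LatticeModels.Site.supNorm (s y - x₀)) :
    |∑ y : Site 4 L, ∑ p : {p : Fin 4 × Fin 4 // p.1 < p.2},
        (N : ℝ) * cov[F, zdPlaquetteObs (fundamentalRep (Fin N)) (s y) p.1.1 p.1.2;
          torusState (d := 4) (fundamentalRep (Fin N)) b L]| ≤
      N * (numOrient 4 * (4 * (2 * Real.sqrt N) ^ 2 * Real.exp (starRate ρ * (D + 3)) * ((Λ.card : ℝ) * K) *
        (16 * (N : ℝ) ^ 3) * ((1 + Real.exp (-(starRate ρ / 4))) / (1 - Real.exp (-(starRate ρ / 4)))) ^ 4)) := by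
  classical
  set r : ℝ := Real.exp (-(starRate ρ / 4)) with hr
  set A : ℝ := 4 * (2 * Real.sqrt N) ^ 2 * Real.exp (starRate ρ * (D + 3)) * ((Λ.card : ℝ) * K) * (16 * (N : ℝ) ^ 3)
    with hA
  have hκ := starRate_pos hρ0 hρ1
  have hr0 : 0 ≤ r := (Real.exp_pos _).le
  have hr1 : r < 1 := Real.exp_lt_one_iff.2 (by linarith)
  have hA0 : 0 ≤ A := by positivity
  have hN0 : (0 : ℝ) ≤ N := Nat.cast_nonneg N
  have hterm : ∀ (y : Site 4 L) (p : {p : Fin 4 × Fin 4 // p.1 < p.2}),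
      |(N : ℝ) * cov[F, zdPlaquetteObs (fundamentalRep (Fin N)) (s y) p.1.1 p.1.2;
          torusState (d := 4) (fundamentalRep (Fin N)) b L]| ≤ N * (A * r ^ l1 (x₀ - s y)) := by
    intro y p
    rw [abs_mul, abs_of_nonneg hN0]
    exact mul_le_mul_of_nonneg_left
      (abs_cov_plaquette_torusState_le_SU b hρ0 hρ1 hW hF hD hL hs hcen y p) hN0
  have hsinj : Function.Injective s := fun y y' h => by rw [← hs y, ← hs y', h]
  calc |∑ y : Site 4 L, ∑ p : {p : Fin 4 × Fin 4 // p.1 < p.2},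
          (N : ℝ) * cov[F, zdPlaquetteObs (fundamentalRep (Fin N)) (s y) p.1.1 p.1.2;
            torusState (d := 4) (fundamentalRep (Fin N)) b L]|
      ≤ ∑ y : Site 4 L, ∑ p : {p : Fin 4 × Fin 4 // p.1 < p.2},
          |(N : ℝ) * cov[F, zdPlaquetteObs (fundamentalRep (Fin N)) (s y) p.1.1 p.1.2;
            torusState (d := 4) (fundamentalRep (Fin N)) b L]| :=
        (Finset.abs_sum_le_sum_abs _ _).trans (Finset.sum_le_sum fun y _ => Finset.abs_sum_le_sum_abs _ _)
    _ ≤ ∑ y : Site 4 L, ∑ _p : {p : Fin 4 × Fin 4 // p.1 < p.2}, N * (A * r ^ l1 (x₀ - s y)) :=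
        Finset.sum_le_sum fun y _ => Finset.sum_le_sum fun p _ => hterm y p
    _ = N * (numOrient 4 * (A * ∑ y : Site 4 L, r ^ l1 (x₀ - s y))) := by
        simp only [Finset.sum_const, Finset.card_univ, nsmul_eq_mul, numOrient, Finset.mul_sum]
        ring
    _ = N * (numOrient 4 * (A * ∑ x ∈ (Finset.univ : Finset (Site 4 L)).image s, r ^ l1 (x₀ - x))) := by
        rw [Finset.sum_image fun y _ y' _ h => hsinj h]
    _ ≤ N * (numOrient 4 * (A * ((1 + r) / (1 - r)) ^ 4)) := by
        have := sum_pow_l1_sub_le hr0 hr1 x₀ ((Finset.univ : Finset (Site 4 L)).image s)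
        gcongr

end Sum

/-! ### §3 Windows for all couplings below `b₁` from a one-link modulus, with one received sum -/

section Window

/-- **Uniform star windows from a one-link modulus** (`SU(N)`, `N ≥ 1`): if `OneLinkKRModulus N R K` (`K ≥ 0`),
`6 b₁/N ≤ R` and `4K b₁/N ≤ 9/25`, then for every `0 ≤ b ≤ b₁` and every torus `L ≥ 3` the four window clauses hold
with the received sum `ρ₁ = R_G(4K b₁/N)` (`star_window_of_oneLinkKRModulus` + `gaugeR_mono`), and `0 ≤ ρ₁ < 1`.
[folklore] -/
theorem star_window_uniform {L : ℕ} [NeZero L] (hL : 3 ≤ L) (hN : 1 ≤ N) {R K b₁ : ℝ} (hK0 : 0 ≤ K)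
    (hmod : OneLinkKRModulus N R K) (hR : b₁ / N * 6 ≤ R) (h925 : 4 * (K * (b₁ / N)) ≤ 9 / 25)
    {b : ℝ} (h0 : 0 ≤ b) (hb : b ≤ b₁) :
    ∃ Kw : Site 4 L → Edge 4 L → Edge 4 L → ℝ,
      (∀ s y x, 0 ≤ Kw s y x) ∧ (∀ s y x, Kw s y x ≠ 0 → ∀ w ∈ linkEnds y, torusNorm (s - w) ≤ 1) ∧
      IsLinkWindowContraction (d := 4) (L := L) (wilsonPlaqWeight N b) suFrobDist starWin (fun c => Kw c.1) ∧
      ∀ (s : Site 4 L) (x : Edge 4 L), x ∈ vertexStar s → ∑ y, Kw s y x ≤ gaugeR (4 * (K * (b₁ / N))) := by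
  have hN0 : (0 : ℝ) < N := by exact_mod_cast (show 0 < N by omega)
  have hab : |b| / N = b / N := by rw [abs_of_nonneg h0]
  have hbN : b / N ≤ b₁ / N := div_le_div_of_nonneg_right hb hN0.le
  have hb0N : 0 ≤ b / N := div_nonneg h0 hN0.le
  have hR' : |b| / N * 6 ≤ R := by rw [hab]; linarith
  have hc6 : K * (|b| / N) < 1 / 6 := by
    rw [hab]
    have := mul_le_mul_of_nonneg_left hbN hK0
    linarith
  obtain ⟨hKw, hKloc, hH1, hH2⟩ := star_window_of_oneLinkKRModulus (L := L) hL hN hK0 hR' hmod hc6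
  refine ⟨_, hKw, hKloc, hH1, fun s x hx => ?_⟩
  rw [hH2 s x hx, hab]
  have hKb : 0 ≤ 4 * (K * (b / N)) := by positivity
  exact gaugeR_mono hKb (by nlinarith [mul_le_mul_of_nonneg_left hbN hK0]) (by linarith)

/-- The uniform received sum is in `[0, 1)`. [folklore] -/
theorem gaugeR_coef_lt_one {R K b₁ : ℝ} (hK0 : 0 ≤ K) (hb₁ : 0 ≤ b₁ / N) (h925 : 4 * (K * (b₁ / N)) ≤ 9 / 25) :
    0 ≤ gaugeR (4 * (K * (b₁ / N))) ∧ gaugeR (4 * (K * (b₁ / N))) < 1 := by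
  have h0 : 0 ≤ 4 * (K * (b₁ / N)) := by positivity
  have _ := R
  exact ⟨gaugeR_nonneg h0 (by linarith), gaugeR_lt_one_of_le h0 h925⟩

end Window

/-! ### §4 The torus state and the DLR state are Lipschitz in the coupling -/

section Lipschitz

/-- **The `SU(N)` torus state is Lipschitz in the coupling, uniformly in `L > 4D + 4`**, on `[0, b₁]`:
`|∫F dτ_{L,b} − ∫F dτ_{L,b'}| ≤ N · D₄ · A_N ((1+r)/(1−r))^4 · |b − b'|` (mean value theorem on
`hasDerivAt_integral_torusState_SU`, bound `abs_responseSum_torusState_le_SU`, windows `star_window_uniform`).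
[folklore] -/
theorem abs_integral_torusState_sub_le_SU {L : ℕ} [NeZero L] (hN : 1 ≤ N) {R K b₁ : ℝ} (hK0 : 0 ≤ K)
    (hmod : OneLinkKRModulus N R K) (hR : b₁ / N * 6 ≤ R) (h925 : 4 * (K * (b₁ / N)) ≤ 9 / 25)
    {F : LGConfig 4 (Matrix.specialUnitaryGroup (Fin N) ℂ) → ℝ} {Λ : Finset (ZdEdge 4)} {KF : ℝ≥0}
    (hF : IsLipschitzCylinder (fundamentalRep (Fin N)) F Λ KF)
    {x₀ : Literature.Probability.LatticeModels.Site 4} {D : ℕ} (hD : ∀ e ∈ Λ, ‖e.1 - x₀‖ ≤ D) (hL : 4 * D + 4 < L)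
    {b b' : ℝ} (h0 : 0 ≤ b) (hb : b ≤ b₁) (h0' : 0 ≤ b') (hb' : b' ≤ b₁) :
    |(∫ U, F U ∂(torusState (d := 4) (fundamentalRep (Fin N)) b L)) -
        ∫ U, F U ∂(torusState (d := 4) (fundamentalRep (Fin N)) b' L)| ≤
      N * (numOrient 4 * (4 * (2 * Real.sqrt N) ^ 2 * Real.exp (starRate (gaugeR (4 * (K * (b₁ / N)))) * (D + 3)) *
        ((Λ.card : ℝ) * KF) * (16 * (N : ℝ) ^ 3) *
        ((1 + Real.exp (-(starRate (gaugeR (4 * (K * (b₁ / N)))) / 4))) /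
          (1 - Real.exp (-(starRate (gaugeR (4 * (K * (b₁ / N)))) / 4)))) ^ 4)) * |b - b'| := by
  classical
  haveI : SecondCountableTopology (Matrix (Fin N) (Fin N) ℂ) :=
    inferInstanceAs (SecondCountableTopology (Fin N → Fin N → ℂ))
  haveI : SecondCountableTopology (Matrix.specialUnitaryGroup (Fin N) ℂ) :=
    Topology.IsEmbedding.subtypeVal.secondCountableTopology
  have hN0 : (0 : ℝ) < N := by exact_mod_cast (show 0 < N by omega)
  set ρ := gaugeR (4 * (K * (b₁ / N))) with hρ
  have hb₁N : 0 ≤ b₁ / N := div_nonneg (h0.trans hb) hN0.le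
  obtain ⟨hρ0, hρ1⟩ := gaugeR_coef_lt_one (N := N) (R := R) hK0 hb₁N h925
  obtain ⟨s, hs, hcen, -⟩ := exists_centredLift L x₀ (d := 4)
  set B : ℝ := N * (numOrient 4 * (4 * (2 * Real.sqrt N) ^ 2 * Real.exp (starRate ρ * (D + 3)) *
    ((Λ.card : ℝ) * KF) * (16 * (N : ℝ) ^ 3) *
    ((1 + Real.exp (-(starRate ρ / 4))) / (1 - Real.exp (-(starRate ρ / 4)))) ^ 4)) with hB
  set φ : ℝ → ℝ := fun t => ∫ U, F U ∂(torusState (d := 4) (fundamentalRep (Fin N)) t L) with hφ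
  have hFb : ∀ U, |F U| ≤ |F 1| + 2 * KF := fun U => hF.abs_le U
  have hderiv : ∀ t ∈ Set.Icc (0 : ℝ) b₁, HasDerivWithinAt φ
      (∑ y : Site 4 L, ∑ p : {p : Fin 4 × Fin 4 // p.1 < p.2},
        (N : ℝ) * cov[F, zdPlaquetteObs (fundamentalRep (Fin N)) (s y) p.1.1 p.1.2;
          torusState (d := 4) (fundamentalRep (Fin N)) t L]) (Set.Icc (0 : ℝ) b₁) t :=
    fun t _ => (hasDerivAt_integral_torusState_SU (d := 4) (N := N) hF.measurable hFb hs t).hasDerivWithinAt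
  have hbound : ∀ t ∈ Set.Icc (0 : ℝ) b₁,
      ‖∑ y : Site 4 L, ∑ p : {p : Fin 4 × Fin 4 // p.1 < p.2},
        (N : ℝ) * cov[F, zdPlaquetteObs (fundamentalRep (Fin N)) (s y) p.1.1 p.1.2;
          torusState (d := 4) (fundamentalRep (Fin N)) t L]‖ ≤ B := by
    intro t ht
    have hWt := star_window_uniform (L := L) (by omega) hN hK0 hmod hR h925 ht.1 ht.2
    rw [Real.norm_eq_abs]
    exact abs_responseSum_torusState_le_SU t hρ0 hρ1 hWt hF hD hL hs hcen
  have hmv := (convex_Icc (0 : ℝ) b₁).norm_image_sub_le_of_norm_hasDerivWithin_le hderiv hbound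
    (show b' ∈ Set.Icc (0 : ℝ) b₁ from ⟨h0', hb'⟩) (show b ∈ Set.Icc (0 : ℝ) b₁ from ⟨h0, hb⟩)
  rw [Real.norm_eq_abs, Real.norm_eq_abs] at hmv
  exact hmv

/-- **C-LIP AT THE STAR WINDOW, every `SU(N)`** (`N ≥ 1`, `d = 4`): under `OneLinkKRModulus N R K` (`K ≥ 0`),
`6 b₁/N ≤ R`, `4K b₁/N ≤ 9/25`, for all `0 ≤ b, b' ≤ b₁`, the (unique) DLR states `μ` at `b` and `ν` at `b'`, and every
Lipschitz cylinder `F`: `|∫F dμ − ∫F dν| ≤ N · D₄ · A_N ((1+r)/(1−r))^4 · |b − b'|`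
(uniqueness `StarSUN.hasUniqueGibbsMeasure_of_oneLinkKRModulus`, limit `tendsto_integral_torusState_of_subsingleton`).
[folklore] -/
theorem abs_integral_sub_integral_le_star_SU (hN : 1 ≤ N) {R K b₁ : ℝ} (hK0 : 0 ≤ K)
    (hmod : OneLinkKRModulus N R K) (hR : b₁ / N * 6 ≤ R) (h925 : 4 * (K * (b₁ / N)) ≤ 9 / 25)
    {b b' : ℝ} (h0 : 0 ≤ b) (hb : b ≤ b₁) (h0' : 0 ≤ b') (hb' : b' ≤ b₁)
    {μ ν : Measure (LGConfig 4 (Matrix.specialUnitaryGroup (Fin N) ℂ))}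
    (hμ : μ ∈ ymGibbsMeasures (d := 4) (fundamentalRep (Fin N)) b)
    (hν : ν ∈ ymGibbsMeasures (d := 4) (fundamentalRep (Fin N)) b')
    {F : LGConfig 4 (Matrix.specialUnitaryGroup (Fin N) ℂ) → ℝ} {Λ : Finset (ZdEdge 4)} {KF : ℝ≥0}
    (hF : IsLipschitzCylinder (fundamentalRep (Fin N)) F Λ KF)
    {x₀ : Literature.Probability.LatticeModels.Site 4} {D : ℕ} (hD : ∀ e ∈ Λ, ‖e.1 - x₀‖ ≤ D) :
    |(∫ U, F U ∂μ) - ∫ U, F U ∂ν| ≤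
      N * (numOrient 4 * (4 * (2 * Real.sqrt N) ^ 2 * Real.exp (starRate (gaugeR (4 * (K * (b₁ / N)))) * (D + 3)) *
        ((Λ.card : ℝ) * KF) * (16 * (N : ℝ) ^ 3) *
        ((1 + Real.exp (-(starRate (gaugeR (4 * (K * (b₁ / N)))) / 4))) /
          (1 - Real.exp (-(starRate (gaugeR (4 * (K * (b₁ / N)))) / 4)))) ^ 4)) * |b - b'| := by
  haveI : SecondCountableTopology (Matrix (Fin N) (Fin N) ℂ) :=
    inferInstanceAs (SecondCountableTopology (Fin N → Fin N → ℂ))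
  haveI : SecondCountableTopology (Matrix.specialUnitaryGroup (Fin N) ℂ) :=
    Topology.IsEmbedding.subtypeVal.secondCountableTopology
  have hN0 : (0 : ℝ) < N := by exact_mod_cast (show 0 < N by omega)
  have hFc : Continuous F := continuous_of_isLipschitzCylinder hF
  have hFb : ∀ U, |F U| ≤ |F 1| + 2 * KF := fun U => hF.abs_le U
  have huniq : ∀ {t : ℝ}, 0 ≤ t → t ≤ b₁ →
      HasUniqueGibbsMeasure (ymSpecification (d := 4) (fundamentalRep (Fin N)) t) := by
    intro t ht0 ht
    have hab : |t| / N = t / N := by rw [abs_of_nonneg ht0]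
    have htN : t / N ≤ b₁ / N := div_le_div_of_nonneg_right ht hN0.le
    refine StarSUN.hasUniqueGibbsMeasure_of_oneLinkKRModulus hN hK0 ?_ hmod ?_
    · rw [hab]; linarith
    · rw [hab]; nlinarith [mul_le_mul_of_nonneg_left htN hK0]
  have tμ := tendsto_integral_torusState_of_subsingleton (d := 4) (fundamentalRep (Fin N))
    (continuous_fundamentalRep (Fin N)) (huniq h0 hb).1 hμ hFc hFb
  have tν := tendsto_integral_torusState_of_subsingleton (d := 4) (fundamentalRep (Fin N))
    (continuous_fundamentalRep (Fin N)) (huniq h0' hb').1 hν hFc hFb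
  refine le_of_tendsto (tμ.sub tν).abs ?_
  filter_upwards [Filter.eventually_ge_atTop (4 * D + 4)] with L hL
  exact abs_integral_torusState_sub_le_SU (L := L + 1) hN hK0 hmod hR h925 hF hD (by omega) h0 hb h0' hb'

/-- ★ **C-LIP AT THE STAR WINDOW FOR EVERY `SU(N)`, `N ≥ 2`, HYPOTHESIS-FREE** (Bakry–Émery modulus
`oneLinkKRModulus_SU`, `K = 1/(1/2 − 6·9/308)`, `b₁ = N · 9/308`): for all tree couplings `0 ≤ b, b' ≤ N·9/308`
('t Hooft `≤ 9/308`; printed Shen–Zhu–Zhu window `1/48`) the DLR states are Lipschitz in the coupling on every Lipschitz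
cylinder observable, with the explicit constant of `abs_integral_sub_integral_le_star_SU`. [folklore] -/
theorem abs_integral_sub_integral_le_SU_thooft (hN : 2 ≤ N) {b b' : ℝ} (h0 : 0 ≤ b) (hb : b / N ≤ 9 / 308)
    (h0' : 0 ≤ b') (hb' : b' / N ≤ 9 / 308)
    {μ ν : Measure (LGConfig 4 (Matrix.specialUnitaryGroup (Fin N) ℂ))}
    (hμ : μ ∈ ymGibbsMeasures (d := 4) (fundamentalRep (Fin N)) b)
    (hν : ν ∈ ymGibbsMeasures (d := 4) (fundamentalRep (Fin N)) b')
    {F : LGConfig 4 (Matrix.specialUnitaryGroup (Fin N) ℂ) → ℝ} {Λ : Finset (ZdEdge 4)} {KF : ℝ≥0}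
    (hF : IsLipschitzCylinder (fundamentalRep (Fin N)) F Λ KF)
    {x₀ : Literature.Probability.LatticeModels.Site 4} {D : ℕ} (hD : ∀ e ∈ Λ, ‖e.1 - x₀‖ ≤ D) :
    |(∫ U, F U ∂μ) - ∫ U, F U ∂ν| ≤
      N * (numOrient 4 * (4 * (2 * Real.sqrt N) ^ 2 *
        Real.exp (starRate (gaugeR (4 * (1 / (1 / 2 - (N : ℝ) * (9 / 308) / N * 6) * ((N : ℝ) * (9 / 308) / N)))) *
          (D + 3)) * ((Λ.card : ℝ) * KF) * (16 * (N : ℝ) ^ 3) *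
        ((1 + Real.exp (-(starRate (gaugeR (4 * (1 / (1 / 2 - (N : ℝ) * (9 / 308) / N * 6) *
            ((N : ℝ) * (9 / 308) / N)))) / 4))) /
          (1 - Real.exp (-(starRate (gaugeR (4 * (1 / (1 / 2 - (N : ℝ) * (9 / 308) / N * 6) *
            ((N : ℝ) * (9 / 308) / N)))) / 4)))) ^ 4)) * |b - b'| := by
  have hN0 : (0 : ℝ) < N := by exact_mod_cast (show 0 < N by omega)
  set b₁ : ℝ := (N : ℝ) * (9 / 308) with hb₁
  have hb₁N : b₁ / N = 9 / 308 := by rw [hb₁]; field_simp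
  have hb₁0 : 0 ≤ b₁ := by positivity
  have hq : b₁ / N ≤ 9 / 308 := hb₁N.le
  obtain ⟨h1, hK0, h4⟩ := StarSUN.bakryEmery_coef_le (by omega) hb₁0 hq
  have hab : |b₁| / N = b₁ / N := by rw [abs_of_nonneg hb₁0]
  rw [hab] at h1 hK0 h4
  have hmod := oneLinkKRModulus_SU hN h1
  have hbb : b ≤ b₁ := by
    rw [hb₁]; have := (div_le_iff₀ hN0).1 hb; linarith
  have hbb' : b' ≤ b₁ := by
    rw [hb₁]; have := (div_le_iff₀ hN0).1 hb'; linarith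
  exact abs_integral_sub_integral_le_star_SU (by omega) hK0 hmod le_rfl h4 h0 hbb h0' hbb' hμ hν hF hD

end Lipschitz

end Summit.Ventures.YMGap.CouplingResponse

end
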